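import Literature.MathematicalPhysics.QuantumFieldTheory.Balaban1983to89.B9Cor36CutoffField337
import Literature.MathematicalPhysics.QuantumFieldTheory.Balaban1983to89.B9Cor36GpCubeLocLetter
import Literature.MathematicalPhysics.QuantumFieldTheory.Balaban1983to89.B9Eq358TaxiLettersY

/-!
# `Balaban1983to89.B9Cor36CubeCutoffs` — [Balaban1985BackgroundPropagators] COROLLARY 3.6 p. 408 + Sect. C p. 408–409 AT ONE COVER CUBE □: the two
# plateau cut-offs `χ_□ ≺ χ̃_□` of the (R)-design, the row set `D_□` of `h_□`, the localised configuration `Ṽ_□ = e^{iηχ̃_□A}`, and — from the (3.35)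
# datum on a cube `Q ⊇ □̃⁵` — the discharge of ALL geometric hypotheses of FILE 2 (`hD`, `hnear`, `hχ`, `hagree`) and of FILE 3's reading
# hypotheses: M5.5 FILE 6's `hloc`∕`hlocT` for the letter `O_□ = χ_□R(u)⁻¹G′_□(Ṽ_□)R(u)χ_□` modulo `IsUnit Δ′_{a,□}(Ṽ_□)` only, and the five
# (3.37)-readings of `thm34_Gp_uniform` for `Ã_□ = χ̃_□·A` — sub-row G-B9-LETTERS, module M5.1b-G′ (site sector), FILE 4 of seat p33's plan

statement-level skeleton of published theorems with citation tags; proofs where landed; nothing here is a claim about the Yang–Mills mass gap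

CITATION HEADER (lean-in-tree rule).  B9 = T. Bałaban, *Propagators for lattice gauge theories in a background field*, Commun. Math. Phys. **99** (1985)
389–434 [Balaban1985BackgroundPropagators] (held `paper:balaban1985-cmp99-background-propagators`; journal page = PDF page + 388).  Cor. 3.6 p. 408 [PDF 20]
l. 3–9 «Applying the gauge transformation u we get U′ = U^u = e^{iηA} with A satisfying the inequalities in (3.35) for j = k. This implies that U′ satisfies
(3.37) for the sequence {Ω′_j} with U = 1 and α₁ = O(1)Mα₀ … All the results of these theorems are gauge invariant, so they hold for the configuration U
also»; Sect. C p. 408 l. 26–28 (the cubes □̃ⁿ of size (2 + 2n)MLʲη), l. 36–44 (the sequence {Ω_n(□)}, «Ω₀(□) ⊂ □̃⁵»), p. 409 [PDF 21] l. 1–3 «the cube □̃⁵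
is contained in one of the cubes for which this condition holds, and the sequence {Ω_n(□)} satisfies the assumptions of Corollary 3.6», (3.87)–(3.88)
p. 409 (`h_□`, `G′₀ = Σ_□ h_□G′_□h_□`), p. 410 l. 14–15 («G′_□ depends on U restricted to Ω₀(□) ⊂ □̃⁵»); (3.35) p. 396, (3.40) p. 397, (3.19) p. 393.
[4] = [Balaban1984PropagatorsII] (2.1)–(2.2) p. 224, (2.36) p. 229, p. 247 «|∂h_□| ≤ O(1)(MLʲη)⁻¹»; [4-I] = [Balaban1984PropagatorsI] (1.118) p. 36.
Rows B9.Cor3.6 × B9.Eq3.87 × B9.Eq3.35 (cells only; no row head changes).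

WHY THIS FILE (cell lit-balaban, sub-row G-B9-LETTERS, module M5.1b-G′ booked to seat p33 g96 by the map owner r06 g67; design memo
`lit-balaban-p33/COR35GP-STATEMENTS-p33.md` v1 §1; ruling (R): the cube letters are r05's full-torus operators of the cube sequence).  FILE 2
`B9Cor36GpCubeLocLetter` derived M5.5 FILE 6's local-inverse laws `hloc`∕`hlocT` for the U-constant letter `locLetterY i □ parS u χ Ṽ` from FIVE
hypotheses (`hD`, `hnear`, `hχ`, `hagree`, `hunit`); FILE 3 `B9Cor36CutoffField337` derived the (3.37)-readings of `thm34_Gp_uniform` for a cut-off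
field `χ̃·A` from plateau ∕ support ∕ Lipschitz facts of `χ̃`.  THIS FILE FIXES THE CUBE'S OBJECTS and discharges every geometric hypothesis:
`χ_□ := bumpY (ctr β) (4S_j)` (`= 1` within `3S_j` of the centre of `β`, `= 0` beyond `3.5S_j`), `χ̃_□ := bumpY (ctr β) (5S_j)` (`= 1` within
`3.75S_j`, `= 0` beyond `4.375S_j`), `D_□ := {z : stencil(z) ∩ supp h_□ ≠ ∅}` (within `2S_j`), `Ṽ_□ := e^{iηχ̃_□A}·1` — so that FILE 6's two laws
hold for `O_□` given only the (3.35) datum on a torus cube `Q` containing every point within `4.375S_j + 1 (< 6S_j)` of the centre of `β`, i.e.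
ON PRINT's □̃⁵ (half-width `6S_j`; p. 409 l. 1–3), and `IsUnit Δ′_{a,□}(Ṽ_□)` (Theorem 3.4's first conjunct, FILE 5).  `S_j = M_h·L^{j+1}` is the
big-block side of the cube's level in lattice units (print's `MLʲη`).

WHAT IS PROVED (5 `def`s with bodies — `NearC`, `ctrR`, `chiY`, `chiTY`, `DthY`, `locCfgY` (6) — and 1 `abbrev` `SC`; 0 sorry; 0 new named facts;
standard axioms):
* §1 TORUS ARITHMETIC: ★`circR_intCast` (the real torus distance `dist(·, Nℤ)` of FILE 3's `bumpY` IS the integer `circAbs` on lattice points);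
  `NearC i □ r x` (every coordinate within integer torus distance `r` of the centre of `β`), `nearC_of_hT_ne_zero` (r05: `supp h_□ ⊂ NearC S_j`),
  `nearC_tshift`∕`nearC_shiftY`∕`nearC_shiftY_symm` (one step costs `1`), `abs_sub_le_of_blkOf_eq`∕`levY_eq_of_blkOf_eq`∕`nearC_of_blkOf_eq` (a
  block-mate costs `L^{lev} − 1`), ★`nearH_of_nearC` (`NearC 3S_j ⊂ NearH`, the numerology `3S_j + m_LS_j ≤ widH_j` for `L ≥ 3`),
  `levY_le_succ_of_nearC`∕`pow_levY_le_SC` (near □ the member's level is `≤ j + 1`, so `L^{lev} ≤ S_j`), ★`nearC_of_mem_stencilY` (the `K(h)`-stencil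
  of a site within `r ≤ 2S_j` lies within `r + S_j`);
* §2 THE CUT-OFFS AND `D_□`: ★`mem_DthY` (= FILE 2's `hD`), `nearC_of_mem_stencilY_rev`, ★`nearC_of_mem_DthY` (`D_□ ⊂ NearC 2S_j`), ★★`nearH_of_mem_DthY`
  (= FILE 2's `hnear`), `chiY_eq_one_of_nearC`, ★★`chiY_eq_one_of_mem_stencilY` (= FILE 2's `hχ`), `nearC_of_chiY_ne_zero` (`supp χ_□ ⊂ NearC 3.5S_j`),
  `chiTY_eq_one_of_nearC`, `nearC_of_chiTY_ne_zero` (`supp χ̃_□ ⊂ NearC 4.375S_j`), ★`chiTY_eq_one_near_of_chiY_ne_zero` (the plateau chain: `χ̃_□ = 1`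
  on `supp χ_□` and its lattice neighbours — FILE 6's Leibniz step), `abs_chiY_le_one`, `abs_chi_shiftY_sub_le` (one step costs `D₁θ/(4S_j)`,
  `D₁θ/(5S_j)`);
* §3 AGREEMENT: ★★`agreeNearY_DthY_of_near` (two configurations agreeing on the bonds based within `3S_j + 1` agree in def-Y's `AgreeNearY` on `D_□`:
  the bonds at `z`, `z − e_μ` and — by N06's `B9Eq358TaxiLettersY.blkOf_toBox_rung_eq` — every rung of the taxi runs `z ⇄ c(z) ⇄ w` inside the block
  of `z`), `fluct_cutFldY_of_eq_one`, `locCfgY`∕`locCfgY_apply`, ★★`agreeNearY_DthY_locCfgY` (= FILE 2's `hagree` for `Ṽ_□`, from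
  `U^u = e^{iηA}` on the bonds of `Q ⊇ NearC (3S_j + 2)`);
* §4 FROM THE DATUM: ★`exists_gauge_fld_of_reg335Cube` (p21's unpacking of `B9Eq335RegularityClasses.Reg335Cube` with the field `A` exposed: a
  bi-contractive gauge `u` on the torus and `A` with `U^u = e^{iηA}` on the bonds of `Q` and `|A| ≤ Cξ⁻¹`, `|η⁻¹∂A| ≤ Cξ⁻²` on `Q`), ★★`readings337_locFld`
  (the five reading binders `h337B`∕`h337F`∕`h337Bτ`∕`hA`∕`hAτB` of `thm34_Gp_uniform` for `chartA i (χ̃_□·A)` at the base `1` against any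
  `0 < len ≤ Λξ`, `α₁ := max C (C(1 + D₁θ))·Λ²`, for a datum scale `ξ ≤ 5S_jη` and `Q ⊇ NearC (4.375S_j + 1)`), `scaleLen_levCubeY_bounds` (the cube
  sequence's `len = L^{lev_□}η ≤ L^{j+1}η`), ★★★`localInverse_laws_locLetterY` (FILE 6's `hloc` AND `hlocT` for
  `O_□ = locLetterY i □ parS u χ_□ Ṽ_□` with `h := h_□`, for any transporter letter with gauge law + locality, modulo `IsUnit Δ′_{a,□}(Ṽ_□)`),
  `localInverse_laws_locLetterY_parSymY` (at `parSymY`, laws by NODE 00), `localInverse_laws_hTY_parSymY` (typed at the consumer's binders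
  `c : ↥(cubes i.D.toDomains)`, `hTY i c`).

PROOF.  Ours; torus bookkeeping over r05's cube-sequence geometry (`B9CubeSequence408`, `B9CubeCutoffNearH`), p38's stencil (`B9Thm37CubeCoverCommutators.stencilY`),
def-Y's block dictionary (`B6Geom246MultiLevelBox.coord_bounds`, `B9Thm311DeltaPrimeSymm.avgCoeffY_eq_ite`), N06's taxi-rung lemma, FILE 3's `bumpY`.

HONEST SCOPE / NOT CLAIMED.  (i) The cut-offs `χ_□`, `χ̃_□` and `Ṽ_□` are the (R)-DESIGN's replacement for print's restriction of `U` to `Ω₀(□) ⊂ □̃⁵` with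
Dirichlet rows (declared in FILE 2's header and the memo; map owner's word 2026-08-28): print has `G′_□(U)` depend on `U|Ω₀(□)` by construction, here the
full-torus letter is evaluated at the globally defined `Ṽ_□ = e^{iηχ̃_□A}`, which equals `U^u` on the bonds within `3.75S_j` of the centre of `β` and is
`1` beyond `4.375S_j`.  (ii) The datum is asked on a torus set `Q` containing the points within `4.375S_j + 1` of the centre of `β` — inside print's □̃⁵
(half-width `6S_j`), so p. 409 l. 1–3 is the printed source of the hypothesis; WHICH class cube supplies it (def-Y's `IsCube396` reads «≤ 10» big blocks where
print p. 396 has «≧ 10» and p. 409 «equal to 12» — cell erratum N-c5-7, question (Q1) of the memo, for the lead and def-Y) is NOT decided here: `Q`, `ξ`, `C`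
are parameters.  (iii) `ξ ≤ 5S_jη` covers the datum scales `L^{j₀}η`, `j₀ ≤ j + 1`; the constant `D₁θ = sup|θ′|` of [4-I]'s profile is not evaluated.
(iv) The gauge is extended by `1` off `Q` (`‖1‖ ≤ 1` assumed, as in p21's `B9Cor36GaugeReductionCube`).  Nothing on `d = 4`, the continuum, reflection
positivity or the mass gap; NOT a node discharge; no row head changes.

RELATED IN THE TREE, NOT DUPLICATED: r05's `B9CubeCutoffNearH.nearH_of_hT` (`supp h_□ ⊂ NearH`; here the thickening `D_□` is needed), p21's
`B9Cor36GaugeReductionCube.exists_gauge_small337_of_reg335Cube` (hides `A`; §4 exposes it), def-Y's `Node00.OpsYLocalInverseAgree` (the agreement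
predicate and the locality of `Δ′_a`, consumed BY NAME), FILES 1–3 of this module.
-/

noncomputable section

namespace Literature.MathematicalPhysics.QuantumFieldTheory.Balaban1983to89.B9Cor36CubeCutoffs

open Literature.MathematicalPhysics.QuantumFieldTheory.Balaban1983to89
open Literature.MathematicalPhysics.QuantumFieldTheory.Balaban1983to89.B4PartitionUnity22 (thetaProf D1 D1_nonneg contDiff_thetaProf hasCompactSupport_thetaProf)
open Literature.MathematicalPhysics.QuantumFieldTheory.Balaban1983to89.B6Partition118KLevelTorus (circR circR_nonneg circR_add_mul circR_le_abs_sub_mul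
  hT thetaT_ne_zero_of_hT_ne_zero)
open Literature.MathematicalPhysics.QuantumFieldTheory.Balaban1983to89.B4TorusKernel.MultiPeriod (circAbs centre abs_add_mul_centre circAbs_le_abs
  circAbs_add_mul circAbs_nonneg)
open Literature.MathematicalPhysics.QuantumFieldTheory.Balaban1983to89.B4Sect5Torus (circAbs_add_le)
open Literature.MathematicalPhysics.QuantumFieldTheory.Balaban1983to89.B4Reflection242 (boxDom blk)
open Literature.MathematicalPhysics.QuantumFieldTheory.Balaban1983to89.B6MultiLevelBoxOperator (N0 bigSide one_le_bigSide)
open Literature.MathematicalPhysics.QuantumFieldTheory.Balaban1983to89.B6MultiLevelTorusOperator (tshift tshift_val_eq_translate tshift_symm_apply unitVec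
  one_le_of_mem one_le_N0)
open Literature.MathematicalPhysics.QuantumFieldTheory.Balaban1983to89.B6Cover236MultiLevelBlocks (cubes)
open Literature.MathematicalPhysics.QuantumFieldTheory.Balaban1983to89.B6Geom246MultiLevelBox (blkOf coord_bounds lev_eq_of_blkOf_eq)
open Literature.MathematicalPhysics.QuantumFieldTheory.Balaban1983to89.B6KLevelCensusIndexV1 (KIdx)
open Literature.MathematicalPhysics.QuantumFieldTheory.Balaban1983to89.B9CubeSequence408 (sI hf mL widH ctrC ctrH NearH sI_pos two_mul_hf_add_one
  two_mul_mL mL_nonneg abs_ctrC_sub_ctrH_le lev_cubeFam_le_succ one_le_cube_level)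
open Literature.MathematicalPhysics.QuantumFieldTheory.Balaban1983to89.B9CubeCutoffNearH (circAbs_le_of_thetaT_ne_zero)
open Literature.MathematicalPhysics.QuantumFieldTheory.Balaban1983to89.B9CubeLettersOpsL0 (oddMh two_le_R cubeFamY levCubeY levCubeY_eq_levY_of_nearH)
open Literature.MathematicalPhysics.QuantumFieldTheory.Balaban1983to89.B9Thm311DeltaPrimeSymm (avgCoeffY_eq_ite)
open Literature.MathematicalPhysics.QuantumFieldTheory.Balaban1983to89.B9Thm37CubeCoverCommutators (stencilY self_mem_stencilY shiftY_mem_stencilY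
  shiftY_symm_mem_stencilY)
open Literature.MathematicalPhysics.QuantumFieldTheory.Balaban1983to89.B9Cor36CutoffField337 (bumpY bumpY_eq_one lt_of_bumpY_ne_zero abs_bumpY_le_one
  abs_bumpY_shiftY_sub_le abs_bumpY_shiftY_symm_sub_le)
open Literature.MathematicalPhysics.QuantumFieldTheory.Balaban1983to89.B9Eq358TaxiLettersY (val_sub_corner val_sub_corner_self blkOf_toBox_rung_eq)
open Literature.MathematicalPhysics.QuantumFieldTheory.Balaban1983to89.B9Eq39Adjoint (fluct covD covDstar)
open Literature.MathematicalPhysics.QuantumFieldTheory.Balaban1983to89.B9Eq352DivForm (tauB)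
open Literature.MathematicalPhysics.QuantumFieldTheory.Balaban1983to89.B9BackgroundsKLevelV1 (shiftsV1)
open Literature.MathematicalPhysics.QuantumFieldTheory.Balaban1983to89.B9Eq360DeltaPrimeAY (mulY AfldY chartA)
open Literature.MathematicalPhysics.QuantumFieldTheory.Balaban1983to89.B9Cor36CutoffField337 (cutFldY)
open Literature.MathematicalPhysics.QuantumFieldTheory.Balaban1983to89.B6GlobalChartV1 (PV boxEquiv boxEquiv_apply)
open Literature.MathematicalPhysics.QuantumFieldTheory.Balaban1983to89.Node00 (SiteY BlkY CfgY GaugeY toKT shiftY levY avgCoeffY cornerY blkCornerY UboxY gaugeY)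
open Literature.MathematicalPhysics.QuantumFieldTheory.Balaban1983to89.Node00.OpsYLocalInverseAgree (AgreeRunY AgreeNearY taxiBondsY)

variable {d ℓ : ℕ} {hd : 1 ≤ d + 1} {hL : Odd (ℓ + 1) ∧ 1 < ℓ + 1} {b₀ b₁ : ℝ}

/-! ## §1  Torus arithmetic: the real and the integer torus distance agree on lattice points; one step and one block cost `1` and `Lⁿ − 1` -/

/-- on lattice points the real torus distance `dist(a, Nℤ)` IS the integer one. [cite: Balaban1984PropagatorsII, (2.2) p.224 (torus distance), dictionary] -/
theorem circR_intCast {N : ℕ} (hN : 1 ≤ N) (a : ℤ) : circR N (a : ℝ) = ((circAbs N a : ℤ) : ℝ) := by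
  apply le_antisymm
  · have h := circR_le_abs_sub_mul hN (a : ℝ) (-centre N a)
    have e : (a : ℝ) - (N : ℝ) * ((-centre N a : ℤ) : ℝ) = ((a + N * centre N a : ℤ) : ℝ) := by push_cast; ring
    rw [e, ← Int.cast_abs, abs_add_mul_centre hN] at h
    exact h
  · unfold circR
    set r : ℤ := round ((a : ℝ) / N) with hr
    have e : (a : ℝ) - (N : ℝ) * (r : ℝ) = ((a + N * (-r) : ℤ) : ℝ) := by push_cast; ring
    rw [e, ← Int.cast_abs]
    have h1 : circAbs N a ≤ |a + N * (-r)| := by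
      rw [← circAbs_add_mul N a (-r)]; exact circAbs_le_abs hN _
    exact_mod_cast h1

section Geometry

variable (i : KIdx d ℓ hd hL b₀ b₁) (c : ↥(cubes (toKT i).D.toDomains))

/-- the big-block side `S_j = M_h·L^{j+1}` of the cube's level, as an integer. [cite: Balaban1985BackgroundPropagators, p.408, dictionary] -/
abbrev SC : ℤ := sI ℓ (toKT i).Mh c.1.1

/-- **`x` WITHIN `r` OF THE CENTRE OF `β`**: every coordinate of `x` is within integer torus distance `r` of `ctrC □` (file 1's concentric windows
with a free radius). [cite: Balaban1985BackgroundPropagators, p.408 («a cube with a center at the center of □»), dictionary] -/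
def NearC (r : ℤ) (x : Fin (d + 1) → ℤ) : Prop := ∀ μ, circAbs ((toKT i).NB μ) (x μ - ctrC c μ) ≤ r

/-- `NearC` is monotone in the radius. [cite: Balaban1985BackgroundPropagators, p.408, bookkeeping] -/
theorem NearC.mono {r r' : ℤ} (h : r ≤ r') {x : Fin (d + 1) → ℤ} (hx : NearC i c r x) : NearC i c r' x := fun μ => (hx μ).trans h

/-- `1 ≤ S_j`. [cite: Balaban1984PropagatorsII, (2.1) p.224, bookkeeping] -/
theorem one_le_SC : 1 ≤ SC i c := by
  have := sI_pos (ℓ := ℓ) (toKT i).hMh c.1.1; unfold SC; omega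

/-- `L² ≤ S_j` (`j ≥ 1`, `M_h ≥ 1`). [cite: Balaban1984PropagatorsII, (2.1) p.224, bookkeeping] -/
theorem sq_le_SC : ((ℓ : ℤ) + 1) ^ 2 ≤ SC i c := by
  have hj := one_le_cube_level c
  have hMh := (toKT i).hMh
  show ((ℓ : ℤ) + 1) ^ 2 ≤ ((bigSide ℓ (toKT i).Mh c.1.1 : ℕ) : ℤ)
  unfold bigSide
  have h1 : (ℓ + 1) ^ 2 ≤ (ℓ + 1) ^ (c.1.1 + 1) := Nat.pow_le_pow_right (by omega) (by omega)
  have h2 : (ℓ + 1) ^ (c.1.1 + 1) ≤ (toKT i).Mh * (ℓ + 1) ^ (c.1.1 + 1) := Nat.le_mul_of_pos_left _ (by omega)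
  exact_mod_cast h1.trans h2

/-- `L ≥ 3` (odd and `> 1`), so `9 ≤ S_j`. [cite: Balaban1984PropagatorsII, (2.1) p.224, bookkeeping] -/
theorem nine_le_SC : 9 ≤ SC i c := by
  have h3 : (3 : ℤ) ≤ (ℓ : ℤ) + 1 := by
    obtain ⟨m, hm⟩ := hL.1; have := hL.2; omega
  have := sq_le_SC i c
  nlinarith

/-- **WHERE `h_□ ≠ 0`, THE SITE IS WITHIN `S_j` OF THE CENTRE OF `β`** (r05's `circAbs_le_of_thetaT_ne_zero`).
[cite: Balaban1984PropagatorsII, (2.36) p.229; Balaban1984PropagatorsI, (1.118) p.36] -/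
theorem nearC_of_hT_ne_zero {z : SiteY i} (h : hT (toKT i).D c z ≠ 0) : NearC i c (SC i c) z.1 := fun μ =>
  circAbs_le_of_thetaT_ne_zero hL.1 (oddMh i) (toKT i).hMh (toKT i).hP c (thetaT_ne_zero_of_hT_ne_zero (toKT i).D h) μ

/-- a torus translation by `t` moves each coordinate's torus distance to the centre by at most `|t_μ|`. [cite: Balaban1984PropagatorsII, (2.2) p.224, bookkeeping] -/
theorem nearC_tshift {r : ℤ} {z : SiteY i} (hz : NearC i c r z.1) (t : Fin (d + 1) → ℤ) {b : ℤ} (ht : ∀ μ, |t μ| ≤ b) :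
    NearC i c (r + b) (tshift (toKT i).NB t z).1 := by
  intro μ
  have hN : 1 ≤ (toKT i).NB μ := one_le_of_mem z.2 μ
  obtain ⟨m, hm⟩ := tshift_val_eq_translate (toKT i).NB t z
  have e : (tshift (toKT i).NB t z).1 μ - ctrC c μ = (z.1 μ - ctrC c μ + t μ) + (toKT i).NB μ * m μ := by
    rw [hm]; simp only [B4TorusKernel.MultiPeriod.translate, Pi.add_apply]; ring
  rw [e, circAbs_add_mul]
  exact (circAbs_add_le hN _ _).trans (add_le_add (hz μ) ((circAbs_le_abs hN _).trans (ht μ)))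

/-- one forward lattice step costs `1`. [cite: Balaban1984PropagatorsII, (2.2) p.224, bookkeeping] -/
theorem nearC_shiftY {r : ℤ} {z : SiteY i} (hz : NearC i c r z.1) (μ : Fin (d + 1)) : NearC i c (r + 1) (shiftY i μ z).1 := by
  have e : shiftY i μ z = tshift (toKT i).NB ((1 : ℤ) • unitVec μ) z := by rw [one_smul]; rfl
  rw [e]
  refine nearC_tshift i c hz _ fun ν => ?_
  simp only [unitVec, Pi.smul_apply, Pi.single_apply, smul_eq_mul]
  split_ifs <;> simp

/-- one backward lattice step costs `1`. [cite: Balaban1984PropagatorsII, (2.2) p.224, bookkeeping] -/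
theorem nearC_shiftY_symm {r : ℤ} {z : SiteY i} (hz : NearC i c r z.1) (μ : Fin (d + 1)) : NearC i c (r + 1) ((shiftY i μ).symm z).1 := by
  have e : (shiftY i μ).symm z = tshift (toKT i).NB ((-1 : ℤ) • unitVec μ) z := by rw [neg_one_smul]; exact tshift_symm_apply _ _ _
  rw [e]
  refine nearC_tshift i c hz _ fun ν => ?_
  simp only [unitVec, Pi.smul_apply, Pi.single_apply, smul_eq_mul]
  split_ifs <;> simp

/-- **TWO SITES OF ONE BLOCK OF `𝔅` ARE WITHIN `Lⁿ − 1` IN EVERY COORDINATE** (`n` the block's level). [cite: Balaban1984PropagatorsII, (2.1) p.224, bookkeeping] -/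
theorem abs_sub_le_of_blkOf_eq {z w : SiteY i} (h : blkOf (toKT i).D.toDomains w = blkOf (toKT i).D.toDomains z) (μ : Fin (d + 1)) :
    |z.1 μ - w.1 μ| ≤ (((ℓ + 1) ^ levY i z : ℕ) : ℤ) - 1 := by
  have hz := coord_bounds (toKT i).D.toDomains (rfl : blkOf (toKT i).D.toDomains z = blkOf (toKT i).D.toDomains z) μ
  have hw := coord_bounds (toKT i).D.toDomains h μ
  have el : (blkOf (toKT i).D.toDomains z).1.1 = levY i z := (lev_eq_of_blkOf_eq (toKT i).D.toDomains rfl).symm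
  rw [el] at hz hw
  rw [abs_le]; constructor <;> linarith [hz.1, hz.2, hw.1, hw.2]

/-- sites of one block of `𝔅` have one level. [cite: Balaban1984PropagatorsII, (2.3)–(2.4) p.224, bookkeeping] -/
theorem levY_eq_of_blkOf_eq {z w : SiteY i} (h : blkOf (toKT i).D.toDomains w = blkOf (toKT i).D.toDomains z) : levY i w = levY i z := by
  change (toKT i).D.toDomains.lev w.1 = (toKT i).D.toDomains.lev z.1
  rw [lev_eq_of_blkOf_eq (toKT i).D.toDomains rfl, lev_eq_of_blkOf_eq (toKT i).D.toDomains rfl, h]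

/-- a block-mate of a site within `r` is within `r + (Lⁿ − 1)`. [cite: Balaban1984PropagatorsII, (2.1) p.224, bookkeeping] -/
theorem nearC_of_blkOf_eq {r : ℤ} {z w : SiteY i} (h : blkOf (toKT i).D.toDomains w = blkOf (toKT i).D.toDomains z) (hw : NearC i c r w.1) :
    NearC i c (r + ((((ℓ + 1) ^ levY i z : ℕ) : ℤ) - 1)) z.1 := by
  intro μ
  have hN : 1 ≤ (toKT i).NB μ := one_le_of_mem z.2 μ
  have t := circAbs_add_le hN (w.1 μ - ctrC c μ) (z.1 μ - w.1 μ)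
  rw [show w.1 μ - ctrC c μ + (z.1 μ - w.1 μ) = z.1 μ - ctrC c μ by ring] at t
  exact t.trans (add_le_add (hw μ) ((circAbs_le_abs hN _).trans (abs_sub_le_of_blkOf_eq i h μ)))

/-- **WITHIN `3S_j` OF THE CENTRE OF `β` IS NEAR □** (`3S_j + m_L S_j ≤ widH_j` for `L ≥ 3`): file 1's `NearH`, on which the cube family has the
member's levels. [cite: Balaban1985BackgroundPropagators, p.408 (□³ ⊂ Ω_j(□)); Balaban1984PropagatorsII, (2.2) p.224] -/
theorem nearH_of_nearC {r : ℤ} (hr : r ≤ 3 * SC i c) {x : Fin (d + 1) → ℤ} (hx : NearC i c r x) : NearH c x := by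
  intro μ
  have hN : 1 ≤ (toKT i).NB μ := by
    show 1 ≤ N0 ℓ (toKT i).Mh (toKT i).k (toKT i).P μ
    exact one_le_N0 (toKT i).hMh (toKT i).hP μ
  have h1 : circAbs ((toKT i).NB μ) (x μ - ctrC c μ) ≤ 3 * SC i c := (hx μ).trans hr
  have h2 : circAbs ((toKT i).NB μ) (ctrC c μ - ctrH c μ) ≤ mL ℓ * sI ℓ (toKT i).Mh c.1.1 :=
    (circAbs_le_abs hN _).trans (abs_ctrC_sub_ctrH_le hL.1 (oddMh i) (toKT i).hMh c μ)
  have h3 := circAbs_add_le hN (x μ - ctrC c μ) (ctrC c μ - ctrH c μ)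
  rw [show x μ - ctrC c μ + (ctrC c μ - ctrH c μ) = x μ - ctrH c μ by ring] at h3
  have e1 := two_mul_hf_add_one hL.1 (oddMh i) c.1.1
  have e2 := two_mul_mL (ℓ := ℓ) hL.1
  have hm : 1 ≤ mL ℓ := by
    have h3L : (3 : ℤ) ≤ (ℓ : ℤ) + 1 := by obtain ⟨m, hm⟩ := hL.1; have := hL.2; omega
    linarith
  have hS := one_le_SC i c
  have hhf : 0 ≤ hf ℓ (toKT i).Mh c.1.1 := by unfold SC at hS; linarith
  show circAbs (N0 ℓ (toKT i).Mh (toKT i).k (toKT i).P μ) (x μ - ctrH c μ) ≤ widH ℓ (toKT i).Mh c.1.1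
  unfold widH
  unfold SC at h1 hS
  have h3' : circAbs ((toKT i).NB μ) (x μ - ctrH c μ) ≤ 3 * sI ℓ (toKT i).Mh c.1.1 + mL ℓ * sI ℓ (toKT i).Mh c.1.1 := by linarith
  have key : 3 * sI ℓ (toKT i).Mh c.1.1 + mL ℓ * sI ℓ (toKT i).Mh c.1.1 ≤ 3 * (((ℓ : ℤ) + 1) * hf ℓ (toKT i).Mh c.1.1 + mL ℓ) + 1 := by
    rw [← e1, ← e2]; nlinarith
  exact h3'.trans key

/-- near □ the member's level is at most `j + 1` (the cube family's levels are `≤ j + 1` and equal the member's near □).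
[cite: Balaban1985BackgroundPropagators, p.408; Balaban1984PropagatorsII, (2.2) p.224] -/
theorem levY_le_succ_of_nearC {r : ℤ} (hr : r ≤ 3 * SC i c) {z : SiteY i} (hz : NearC i c r z.1) : levY i z ≤ c.1.1 + 1 := by
  rw [← levCubeY_eq_levY_of_nearH i c (nearH_of_nearC i c hr hz)]
  exact lev_cubeFam_le_succ z.1

/-- hence its block side `L^{lev z} ≤ S_j`. [cite: Balaban1984PropagatorsII, (2.1) p.224, bookkeeping] -/
theorem pow_levY_le_SC {r : ℤ} (hr : r ≤ 3 * SC i c) {z : SiteY i} (hz : NearC i c r z.1) : (((ℓ + 1) ^ levY i z : ℕ) : ℤ) ≤ SC i c := by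
  have hl := levY_le_succ_of_nearC i c hr hz
  show (((ℓ + 1) ^ levY i z : ℕ) : ℤ) ≤ ((bigSide ℓ (toKT i).Mh c.1.1 : ℕ) : ℤ)
  unfold bigSide
  have h1 : (ℓ + 1) ^ levY i z ≤ (ℓ + 1) ^ (c.1.1 + 1) := Nat.pow_le_pow_right (by omega) hl
  have h2 : (ℓ + 1) ^ (c.1.1 + 1) ≤ (toKT i).Mh * (ℓ + 1) ^ (c.1.1 + 1) := Nat.le_mul_of_pos_left _ (by have := (toKT i).hMh; omega)
  exact_mod_cast h1.trans h2

/-- **THE STENCIL OF A SITE WITHIN `r ≤ 2S_j` LIES WITHIN `r + S_j`** (neighbours: `+1`; block-mates: `+ (L^{lev} − 1) ≤ S_j − 1`).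
[cite: Balaban1985BackgroundPropagators, (3.88) p.409 (the stencil of K(h)), p.408] -/
theorem nearC_of_mem_stencilY {r : ℤ} (hr : r ≤ 2 * SC i c) {z w : SiteY i} (hz : NearC i c r z.1) (hw : w ∈ stencilY i z) :
    NearC i c (r + SC i c) w.1 := by
  have hS := one_le_SC i c
  unfold stencilY at hw
  simp only [Finset.mem_union, Finset.mem_singleton, Finset.mem_image, Finset.mem_univ, true_and, Finset.mem_filter] at hw
  rcases hw with ((rfl | ⟨μ, rfl⟩) | ⟨μ, rfl⟩) | hw
  · exact hz.mono i c (by linarith)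
  · exact (nearC_shiftY i c hz μ).mono i c (by linarith)
  · exact (nearC_shiftY_symm i c hz μ).mono i c (by linarith)
  · -- a block-mate: `blkOf w = blkOf z`
    have hb : blkOf (toKT i).D.toDomains w = blkOf (toKT i).D.toDomains z := by
      rw [avgCoeffY_eq_ite] at hw
      by_contra hne; exact hw (if_neg hne)
    have h1 := nearC_of_blkOf_eq i c hb.symm hz
    have hp := pow_levY_le_SC i c (show r ≤ 3 * SC i c by linarith) hz
    rw [levY_eq_of_blkOf_eq i hb] at h1
    exact h1.mono i c (by linarith)

end Geometry

/-! ## §2  The two cut-offs of the cube and the row set `D_□`: FILE 2's `hD`, `hnear`, `hχ` discharged for `h := h_□` -/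

section Cutoffs

variable (i : KIdx d ℓ hd hL b₀ b₁) (c : ↥(cubes (toKT i).D.toDomains))

/-- the centre of `β` as a real vector. [cite: Balaban1985BackgroundPropagators, p.408, dictionary] -/
def ctrR : Fin (d + 1) → ℝ := fun μ => (ctrC c μ : ℝ)

/-- **THE INNER CUT-OFF `χ_□`** (the (R)-design's sandwich of the letter): the plateau bump of radius `4S_j` about the centre of `β` — `= 1` within
`3S_j` (so on the stencils of the rows of `D_□`), `= 0` beyond `3.5S_j`. [cite: Balaban1985BackgroundPropagators, Cor. 3.6 p.408, (3.87) p.409; Balaban1984PropagatorsI, (1.118) p.36] -/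
def chiY : SiteY i → ℝ := bumpY i (ctrR i c) (4 * (SC i c : ℝ))

/-- **THE OUTER CUT-OFF `χ̃_□`** (the (R)-design's localisation of the exponent field, `Ṽ_□ = e^{iηχ̃_□A}`): the plateau bump of radius `5S_j` —
`= 1` within `3.75S_j` (so on `supp χ_□ ± e_μ` and on the bonds read near `D_□`), `= 0` beyond `4.375S_j` (inside the datum cube □̃⁵-and-a-bit).
[cite: Balaban1985BackgroundPropagators, Cor. 3.6 p.408 («U′ = U^u = e^{iηA}»), p.409 l.1–3 («the cube □̃⁵ is contained in one of the cubes for which this condition holds»); Balaban1984PropagatorsI, (1.118) p.36] -/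
def chiTY : SiteY i → ℝ := bumpY i (ctrR i c) (5 * (SC i c : ℝ))

open Classical in
/-- **THE ROW SET `D_□`**: the sites whose `K(h)`-stencil meets `supp h_□` (the rows on which FILE 2 needs the agreement of `Δ′_a` and `Δ′_{a,□}`).
[cite: Balaban1985BackgroundPropagators, (3.88) p.409, p.410 L14–15] -/
def DthY : Finset (SiteY i) := Finset.univ.filter fun z => ∃ w ∈ stencilY i z, hT (toKT i).D c w ≠ 0

/-- the real torus distance of a lattice coordinate to the centre is the integer one. [cite: Balaban1984PropagatorsII, (2.2) p.224, dictionary] -/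
theorem circR_coord_eq (z : SiteY i) (μ : Fin (d + 1)) :
    circR ((toKT i).NB μ) ((z.1 μ : ℝ) - ctrR i c μ) = ((circAbs ((toKT i).NB μ) (z.1 μ - ctrC c μ) : ℤ) : ℝ) := by
  rw [ctrR, ← Int.cast_sub, circR_intCast (one_le_of_mem z.2 μ)]

/-- ★ FILE 2's `hD` for `h := h_□`: by definition of `D_□`. [cite: Balaban1985BackgroundPropagators, (3.88) p.409] -/
theorem mem_DthY {z w : SiteY i} (hw : w ∈ stencilY i z) (h : hT (toKT i).D c w ≠ 0) : z ∈ DthY i c := by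
  classical
  unfold DthY
  simp only [Finset.mem_filter, Finset.mem_univ, true_and]
  exact ⟨w, hw, h⟩

/-- the reverse stencil step: if `w ∈ stencil(z)` is within `r ≤ 2S_j`, then `z` is within `r + S_j`. [cite: Balaban1985BackgroundPropagators, (3.88) p.409, p.408] -/
theorem nearC_of_mem_stencilY_rev {r : ℤ} (hr : r ≤ 2 * SC i c) {z w : SiteY i} (hw : NearC i c r w.1) (hmem : w ∈ stencilY i z) :
    NearC i c (r + SC i c) z.1 := by
  have hS := one_le_SC i c
  unfold stencilY at hmem
  simp only [Finset.mem_union, Finset.mem_singleton, Finset.mem_image, Finset.mem_univ, true_and, Finset.mem_filter] at hmem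
  rcases hmem with ((rfl | ⟨μ, rfl⟩) | ⟨μ, rfl⟩) | hmem
  · exact hw.mono i c (by linarith)
  · have h := nearC_shiftY_symm i c hw μ
    rw [Equiv.symm_apply_apply] at h
    exact h.mono i c (by linarith)
  · have h := nearC_shiftY i c hw μ
    rw [Equiv.apply_symm_apply] at h
    exact h.mono i c (by linarith)
  · have hb : blkOf (toKT i).D.toDomains w = blkOf (toKT i).D.toDomains z := by
      rw [avgCoeffY_eq_ite] at hmem
      by_contra hne; exact hmem (if_neg hne)
    have h1 := nearC_of_blkOf_eq i c hb hw
    have hp := pow_levY_le_SC i c (show r ≤ 3 * SC i c by linarith) hw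
    rw [levY_eq_of_blkOf_eq i hb] at hp
    exact h1.mono i c (by linarith)

/-- ★ **THE ROWS OF `D_□` ARE WITHIN `2S_j` OF THE CENTRE OF `β`.** [cite: Balaban1985BackgroundPropagators, (3.88) p.409, p.408] -/
theorem nearC_of_mem_DthY {z : SiteY i} (hz : z ∈ DthY i c) : NearC i c (2 * SC i c) z.1 := by
  classical
  unfold DthY at hz
  simp only [Finset.mem_filter, Finset.mem_univ, true_and] at hz
  obtain ⟨w, hw, h⟩ := hz
  have h1 := nearC_of_mem_stencilY_rev i c (by linarith [one_le_SC i c]) (nearC_of_hT_ne_zero i c h) hw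
  exact h1.mono i c (by linarith)

/-- ★ FILE 2's `hnear` for `h := h_□`: every row of `D_□` is near □. [cite: Balaban1985BackgroundPropagators, (3.88) p.409, p.408 (□³ ⊂ Ω_j(□))] -/
theorem nearH_of_mem_DthY {z : SiteY i} (hz : z ∈ DthY i c) : NearH c z.1 :=
  nearH_of_nearC i c (by linarith [one_le_SC i c]) (nearC_of_mem_DthY i c hz)

/-- the inner cut-off is `1` within `3S_j`. [cite: Balaban1984PropagatorsI, (1.118) p.36; Balaban1985BackgroundPropagators, p.408] -/
theorem chiY_eq_one_of_nearC {r : ℤ} (hr : r ≤ 3 * SC i c) {z : SiteY i} (hz : NearC i c r z.1) : chiY i c z = 1 := by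
  have hS : (1 : ℝ) ≤ (SC i c : ℝ) := by exact_mod_cast one_le_SC i c
  refine bumpY_eq_one i (by positivity) fun ν => ?_
  rw [circR_coord_eq]
  have h1 : ((circAbs ((toKT i).NB ν) (z.1 ν - ctrC c ν) : ℤ) : ℝ) ≤ (r : ℝ) := by exact_mod_cast hz ν
  have h2 : (r : ℝ) ≤ 3 * (SC i c : ℝ) := by exact_mod_cast hr
  linarith

/-- ★ FILE 2's `hχ` for `h := h_□`, `χ := χ_□`: the inner cut-off is `1` on the stencil of every row of `D_□`.
[cite: Balaban1985BackgroundPropagators, (3.88) p.409, Cor. 3.6 p.408] -/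
theorem chiY_eq_one_of_mem_stencilY {z : SiteY i} (hz : z ∈ DthY i c) {w : SiteY i} (hw : w ∈ stencilY i z) : chiY i c w = 1 :=
  chiY_eq_one_of_nearC i c (by linarith [one_le_SC i c]) (nearC_of_mem_stencilY i c le_rfl (nearC_of_mem_DthY i c hz) hw)

/-- where the inner cut-off is non-zero the site is within `3.5S_j`: `2·dist ≤ 7S_j`. [cite: Balaban1984PropagatorsI, (1.118) p.36, bookkeeping] -/
theorem nearC_of_chiY_ne_zero {z : SiteY i} (h : chiY i c z ≠ 0) : NearC i c (7 * SC i c / 2) z.1 := by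
  intro μ
  have hS : (1 : ℝ) ≤ (SC i c : ℝ) := by exact_mod_cast one_le_SC i c
  have h1 := lt_of_bumpY_ne_zero i (by positivity) h μ
  rw [circR_coord_eq] at h1
  have h2 : 2 * circAbs ((toKT i).NB μ) (z.1 μ - ctrC c μ) < 7 * SC i c := by
    have : (2 : ℝ) * ((circAbs ((toKT i).NB μ) (z.1 μ - ctrC c μ) : ℤ) : ℝ) < 7 * (SC i c : ℝ) := by linarith
    exact_mod_cast this
  rw [Int.le_ediv_iff_mul_le (by norm_num : (0 : ℤ) < 2)]
  linarith

/-- the outer cut-off is `1` within `r` whenever `4r ≤ 15S_j`. [cite: Balaban1984PropagatorsI, (1.118) p.36; Balaban1985BackgroundPropagators, p.408] -/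
theorem chiTY_eq_one_of_nearC {r : ℤ} (hr : 4 * r ≤ 15 * SC i c) {z : SiteY i} (hz : NearC i c r z.1) : chiTY i c z = 1 := by
  have hS : (1 : ℝ) ≤ (SC i c : ℝ) := by exact_mod_cast one_le_SC i c
  refine bumpY_eq_one i (by positivity) fun ν => ?_
  rw [circR_coord_eq]
  have h1 : ((circAbs ((toKT i).NB ν) (z.1 ν - ctrC c ν) : ℤ) : ℝ) ≤ (r : ℝ) := by exact_mod_cast hz ν
  have h2 : 4 * (r : ℝ) ≤ 15 * (SC i c : ℝ) := by exact_mod_cast hr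
  linarith

/-- where the outer cut-off is non-zero the site is within `4.375S_j`: `8·dist ≤ 35S_j`. [cite: Balaban1984PropagatorsI, (1.118) p.36, bookkeeping] -/
theorem nearC_of_chiTY_ne_zero {z : SiteY i} (h : chiTY i c z ≠ 0) : NearC i c (35 * SC i c / 8) z.1 := by
  intro μ
  have hS : (1 : ℝ) ≤ (SC i c : ℝ) := by exact_mod_cast one_le_SC i c
  have h1 := lt_of_bumpY_ne_zero i (by positivity) h μ
  rw [circR_coord_eq] at h1
  have h2 : 8 * circAbs ((toKT i).NB μ) (z.1 μ - ctrC c μ) < 35 * SC i c := by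
    have : (8 : ℝ) * ((circAbs ((toKT i).NB μ) (z.1 μ - ctrC c μ) : ℤ) : ℝ) < 35 * (SC i c : ℝ) := by linarith
    exact_mod_cast this
  rw [Int.le_ediv_iff_mul_le (by norm_num : (0 : ℤ) < 8)]
  linarith

/-- ★ **THE PLATEAU CHAIN**: wherever `χ_□(z) ≠ 0`, the outer cut-off is `1` at `z` and at all its lattice neighbours `z ± e_μ` (so `Ṽ_□ = U^u` on every
bond touching `supp χ_□` — the Leibniz step of FILE 6). [cite: Balaban1985BackgroundPropagators, Cor. 3.6 p.408, (3.89) p.409] -/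
theorem chiTY_eq_one_near_of_chiY_ne_zero {z : SiteY i} (h : chiY i c z ≠ 0) (μ : Fin (d + 1)) :
    chiTY i c z = 1 ∧ chiTY i c (shiftY i μ z) = 1 ∧ chiTY i c ((shiftY i μ).symm z) = 1 := by
  have h0 := nearC_of_chiY_ne_zero i c h
  have hS := nine_le_SC i c
  have hb : 4 * (7 * SC i c / 2 + 1) ≤ 15 * SC i c := by omega
  have hb' : 4 * (7 * SC i c / 2) ≤ 15 * SC i c := by omega
  exact ⟨chiTY_eq_one_of_nearC i c hb' h0, chiTY_eq_one_of_nearC i c hb (nearC_shiftY i c h0 μ),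
    chiTY_eq_one_of_nearC i c hb (nearC_shiftY_symm i c h0 μ)⟩

/-- `|χ_□| ≤ 1`, `|χ̃_□| ≤ 1`. [cite: Balaban1984PropagatorsI, (1.118) p.36, bookkeeping] -/
theorem abs_chiY_le_one (z : SiteY i) : |chiY i c z| ≤ 1 ∧ |chiTY i c z| ≤ 1 := ⟨abs_bumpY_le_one i _ _ z, abs_bumpY_le_one i _ _ z⟩

/-- one lattice step costs `χ_□` at most `D₁θ/(4S_j)` and `χ̃_□` at most `D₁θ/(5S_j)` (print: `|∂h| ≤ O(1)(MLʲη)⁻¹`).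
[cite: Balaban1984PropagatorsII, p.247 («|∂h_□| ≤ O(1)(MLʲη)⁻¹»); Balaban1985BackgroundPropagators, (3.89) p.409] -/
theorem abs_chi_shiftY_sub_le (μ : Fin (d + 1)) (z : SiteY i) :
    |chiY i c (shiftY i μ z) - chiY i c z| ≤ D1 thetaProf / (4 * (SC i c : ℝ)) ∧
    |chiY i c ((shiftY i μ).symm z) - chiY i c z| ≤ D1 thetaProf / (4 * (SC i c : ℝ)) ∧
    |chiTY i c (shiftY i μ z) - chiTY i c z| ≤ D1 thetaProf / (5 * (SC i c : ℝ)) ∧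
    |chiTY i c ((shiftY i μ).symm z) - chiTY i c z| ≤ D1 thetaProf / (5 * (SC i c : ℝ)) := by
  have hS : (1 : ℝ) ≤ (SC i c : ℝ) := by exact_mod_cast one_le_SC i c
  exact ⟨abs_bumpY_shiftY_sub_le i _ (by positivity) μ z, abs_bumpY_shiftY_symm_sub_le i _ (by positivity) μ z,
    abs_bumpY_shiftY_sub_le i _ (by positivity) μ z, abs_bumpY_shiftY_symm_sub_le i _ (by positivity) μ z⟩

end Cutoffs

/-! ## §3  The localised configuration `Ṽ_□ = e^{iηχ̃_□A}` agrees with `U^u` near `D_□`: FILE 2's `hagree` -/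

section Agreement

variable {𝔸 : Type} [NormedRing 𝔸] [NormedAlgebra ℂ 𝔸] [CompleteSpace 𝔸]
variable (i : KIdx d ℓ hd hL b₀ b₁) (c : ↥(cubes (toKT i).D.toDomains))

/-- **AGREEMENT NEAR `D_□` IMPLIES `AgreeNearY`**: if two configurations agree on every bond based within `3S_j + 1` of the centre of `β` (read through the
chart), they agree in the sense of def-Y's `AgreeNearY` on `D_□` — the bonds at `z`, `z − e_μ` (`z ∈ D_□`, within `2S_j + 1`) and the rungs of the taxi
runs `z ⇄ c(z) ⇄ w` inside the block of `z` (within `3S_j − 1`, N06's `blkOf_toBox_rung_eq`).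
[cite: Balaban1985BackgroundPropagators, p.410 L14–15 («G′_□ depends on U restricted to Ω₀(□) ⊂ □̃⁵»), (3.40) p.397, (3.19) p.393] -/
theorem agreeNearY_DthY_of_near {W V : CfgY 𝔸 i}
    (hWV : ∀ (κ : Fin (d + 1)) (x : Site (PV d ℓ i.m i.K hd hL) 0), NearC i c (3 * SC i c + 1) (boxEquiv i.hN x).1 → W κ x = V κ x) :
    AgreeNearY i (DthY i c) W V := by
  have hS := one_le_SC i c
  -- a torus point charting to within `r ≤ 3S + 1` is an agreement point
  have key : ∀ (κ : Fin (d + 1)) (z : SiteY i) {r : ℤ}, r ≤ 3 * SC i c + 1 → NearC i c r z.1 → W κ ((boxEquiv i.hN).symm z) = V κ ((boxEquiv i.hN).symm z) :=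
    fun κ z r hr hz => hWV κ _ (by rw [Equiv.apply_symm_apply]; exact hz.mono i c hr)
  -- the rungs of a taxi run between two sites of the block of a row `z ∈ D_□` are agreement points
  have rung : ∀ {z : SiteY i}, z ∈ DthY i c → ∀ (a b : SiteY i), blkOf (toKT i).D.toDomains a = blkOf (toKT i).D.toDomains z →
      blkOf (toKT i).D.toDomains b = blkOf (toKT i).D.toDomains z → ∀ r ∈ taxiBondsY i a b, W r.2.1 r.1 = V r.2.1 r.1 := by
    intro z hz a b ha hb r hr
    have hzD := nearC_of_mem_DthY i c hz
    have hblk : blkOf (toKT i).D.toDomains (B6GlobalChartV1.toBox i.hN r.1) = blkOf (toKT i).D.toDomains z :=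
      blkOf_toBox_rung_eq i (blkOf (toKT i).D.toDomains z) _ _ (fun μ => (val_sub_corner i _ ha μ).2) (fun μ => (val_sub_corner i _ hb μ).2) r hr
    have h1 := nearC_of_blkOf_eq i c hblk.symm hzD
    have hp := pow_levY_le_SC i c (show 2 * SC i c ≤ 3 * SC i c by linarith) hzD
    rw [levY_eq_of_blkOf_eq i hblk] at h1
    have h2 : NearC i c (3 * SC i c + 1) (B6GlobalChartV1.toBox i.hN r.1).1 := h1.mono i c (by linarith)
    have h3 := hWV r.2.1 r.1 (by rw [boxEquiv_apply]; exact h2)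
    exact h3
  refine ⟨fun z hz μ => ?_, fun z hz w hw => ?_⟩
  · have hzD := nearC_of_mem_DthY i c hz
    exact ⟨key μ z (by linarith) hzD, key μ _ (by linarith) (nearC_shiftY_symm i c hzD μ)⟩
  · have hb : blkOf (toKT i).D.toDomains w = blkOf (toKT i).D.toDomains z := by
      rw [avgCoeffY_eq_ite] at hw
      by_contra hne; exact hw (if_neg hne)
    have hc : blkOf (toKT i).D.toDomains (cornerY i (levY i z) z) = blkOf (toKT i).D.toDomains z := by
      rw [B9Thm311DeltaPrimeSymm.cornerY_levY_eq]
      exact B6Geom246MultiLevelBox.blkOf_corner _ _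
    exact ⟨⟨rung hz _ _ rfl hc, rung hz _ _ hc rfl⟩, ⟨rung hz _ _ hc hb, rung hz _ _ hb hc⟩⟩

/-- where `χ̃_□(chart x) = 1` the cut-off field IS the field: `e^{iη(χ̃A)_κ(x)} = e^{iηA_κ(x)}`. [cite: Balaban1985BackgroundPropagators, Cor. 3.6 p.408, bookkeeping] -/
theorem fluct_cutFldY_of_eq_one {χ : SiteY i → ℝ} (η : ℝ) (A : AfldY 𝔸 i) {κ : Fin (d + 1)} {x : Site (PV d ℓ i.m i.K hd hL) 0}
    (h : χ (boxEquiv i.hN x) = 1) : fluct η (cutFldY i χ A) κ x = fluct η A κ x := by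
  unfold fluct
  have e : cutFldY i χ A κ x = A κ x := by
    show ((χ (boxEquiv i.hN x) : ℝ) : ℂ) • A κ x = A κ x
    rw [h, Complex.ofReal_one, one_smul]
  rw [e]

/-- **THE LOCALISED CONFIGURATION `Ṽ_□ := e^{iηχ̃_□A}·1`** of the (R)-design. [cite: Balaban1985BackgroundPropagators, Cor. 3.6 p.408 («U′ = U^u = e^{iηA} … with U = 1»)] -/
def locCfgY (η : ℝ) (A : AfldY 𝔸 i) : CfgY 𝔸 i := mulY i (fluct η (cutFldY i (chiTY i c) A)) fun _ _ => 1

/-- `Ṽ_□` evaluated. [cite: Balaban1985BackgroundPropagators, Cor. 3.6 p.408, bookkeeping] -/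
theorem locCfgY_apply (η : ℝ) (A : AfldY 𝔸 i) (κ : Fin (d + 1)) (x : Site (PV d ℓ i.m i.K hd hL) 0) :
    locCfgY i c η A κ x = fluct η (cutFldY i (chiTY i c) A) κ x := by
  show fluct η (cutFldY i (chiTY i c) A) κ x * 1 = _
  rw [mul_one]

/-- ★★ **FILE 2's `hagree` DISCHARGED**: if `U^u = e^{iηA}` on every bond with both ends in the datum set `Q` (the (3.35) datum, gauge extended by `1`
off `Q`), and `Q` contains every torus point within `3S_j + 2` of the centre of `β`, then `U^u` and `Ṽ_□ = e^{iηχ̃_□A}` agree near `D_□`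
(`χ̃_□ = 1` within `3.75S_j`). [cite: Balaban1985BackgroundPropagators, Cor. 3.6 p.408, p.410 L14–15, p.409 l.1–3] -/
theorem agreeNearY_DthY_locCfgY {W : CfgY 𝔸 i} {Q : Set (Site (PV d ℓ i.m i.K hd hL) 0)} (η : ℝ) (A : AfldY 𝔸 i)
    (hQ : ∀ x : Site (PV d ℓ i.m i.K hd hL) 0, NearC i c (3 * SC i c + 2) (boxEquiv i.hN x).1 → x ∈ Q)
    (hWA : ∀ (κ : Fin (d + 1)) (x : Site (PV d ℓ i.m i.K hd hL) 0), x ∈ Q → x.shift κ ∈ Q → W κ x = fluct η A κ x) :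
    AgreeNearY i (DthY i c) W (locCfgY i c η A) := by
  refine agreeNearY_DthY_of_near i c fun κ x hx => ?_
  have hS := nine_le_SC i c
  have h1 : chiTY i c (boxEquiv i.hN x) = 1 := chiTY_eq_one_of_nearC i c (by omega) hx
  rw [locCfgY_apply, fluct_cutFldY_of_eq_one i η A h1]
  refine hWA κ x (hQ x (hx.mono i c (by linarith))) (hQ _ ?_)
  -- `boxEquiv (x + e_κ) = shiftY κ (boxEquiv x)` (def-Y's `boxEquiv_symm_shiftY`; = `B9B8CarrierDictionary.shiftY_boxEquiv`, not imported)
  have e : boxEquiv i.hN (x.shift κ) = shiftY i κ (boxEquiv i.hN x) := by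
    apply (boxEquiv i.hN).symm.injective
    rw [Node00.boxEquiv_symm_shiftY, Equiv.symm_apply_apply, Equiv.symm_apply_apply]
  rw [e]
  exact nearC_shiftY i c hx κ

end Agreement

/-! ## §4  From the (3.35) datum on a cube `Q ⊇ □̃⁵`: the gauge, the cut-off field's (3.37)-readings, and FILE 2's two laws -/

section Datum

variable {𝔸 : Type} [NormedRing 𝔸] [NormedAlgebra ℂ 𝔸] [CompleteSpace 𝔸]
variable (i : KIdx d ℓ hd hL b₀ b₁) (c : ↥(cubes (toKT i).D.toDomains))

/-- ★ **THE (3.35) DATUM UNPACKED** (p21's `exists_gauge_small337_of_reg335Cube` with the field `A` exposed): a gauge function `u` on the torus that is a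
bi-contraction everywhere (the datum's `u` on `Q`, `1` off `Q` — needs `‖1‖ ≤ 1`), and a field `A` with `U^u = e^{iηA}` on every bond with both ends in
`Q`, `|A| < Cξ⁻¹`, `|η⁻¹∂A| < Cξ⁻²` on `Q`. [cite: Balaban1985BackgroundPropagators, (3.35) p.396, Cor. 3.6 p.408 («Applying the gauge transformation u we get U′ = U^u = e^{iηA}»)] -/
theorem exists_gauge_fld_of_reg335Cube (h1 : ‖(1 : 𝔸)‖ ≤ 1) {U : CfgY 𝔸 i} {Q : Set (Site (PV d ℓ i.m i.K hd hL) 0)} {η ξ C : ℝ}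
    (h : B9Eq335RegularityClasses.Reg335Cube (shiftsV1 (PV d ℓ i.m i.K hd hL)) U η Q ξ C) :
    ∃ (g : GaugeY 𝔸 i) (A : AfldY 𝔸 i), (∀ x, ‖(g x : 𝔸)‖ ≤ 1 ∧ ‖(((g x)⁻¹ : 𝔸ˣ) : 𝔸)‖ ≤ 1) ∧
      (∀ (κ : Fin (d + 1)) (x : Site (PV d ℓ i.m i.K hd hL) 0), x ∈ Q → x.shift κ ∈ Q → gaugeY i g U κ x = fluct η A κ x) ∧
      (∀ κ, ∀ x ∈ Q, ‖A κ x‖ ≤ C * ξ⁻¹) ∧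
      (∀ μ ν, ∀ x ∈ Q, ‖((η : ℂ)⁻¹) • covD (shiftsV1 (PV d ℓ i.m i.K hd hL)) (fun _ _ => (1 : 𝔸ˣ)) μ (A ν) x‖ ≤ C * (ξ ^ 2)⁻¹) := by
  classical
  obtain ⟨u, A, hu, hgA, hA, hdA⟩ := h
  refine ⟨fun x => if x ∈ Q then u x else 1, A, fun x => ?_, fun κ x hx hx' => ?_, fun κ x hx => (hA κ x hx).le, fun μ ν x hx => (hdA μ ν x hx).le⟩
  · by_cases hx : x ∈ Q
    · simp only [if_pos hx]; exact hu x hx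
    · simp only [if_neg hx]; exact ⟨by rw [Units.val_one]; exact h1, by rw [inv_one, Units.val_one]; exact h1⟩
  · simp only [Node00.gaugeY_apply, if_pos hx, if_pos hx']
    rw [← hgA κ x hx, B9Eq3117Current.gaugeTr_apply]
    rfl

omit [CompleteSpace 𝔸] in
/-- ★★ **THE FIVE (3.37)-READINGS OF `thm34_Gp_uniform` FOR THE CUBE'S CUT-OFF FIELD `Ã_□ = χ̃_□·A` AT THE BASE `1`** (FILE 3's `readings337_chartA_cutFldY`
instantiated at `χ̃_□`): from `|A| ≤ Cξ⁻¹`, `|η⁻¹∂A| ≤ Cξ⁻²` on a torus set `Q` containing every point within `4.375S_j + 1` of the centre of `β`, a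
datum scale `ξ ≤ 5S_jη` (any `ξ = L^{j₀}η` with `L^{j₀} ≤ 5M_hL^{j+1}`), and a length function `0 < len ≤ Λξ`, the five readings hold with
`α₁ := max C (C(1 + D₁θ))·Λ²` — print's «α₁ = O(1)Mα₀». [cite: Balaban1985BackgroundPropagators, Cor. 3.6 p.408, (3.35)∕(3.37) p.396, Thm 3.4 p.400] -/
theorem readings337_locFld {A : AfldY 𝔸 i} {Q : Set (Site (PV d ℓ i.m i.K hd hL) 0)} {C η ξ Λ : ℝ} (hC : 0 ≤ C) (hη : 0 < η) (hξ : 0 < ξ)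
    (hΛ : 1 ≤ Λ) (hξS : ξ ≤ 5 * (SC i c : ℝ) * η)
    (hQ : ∀ x : Site (PV d ℓ i.m i.K hd hL) 0, NearC i c (35 * SC i c / 8 + 1) (boxEquiv i.hN x).1 → x ∈ Q)
    (hA : ∀ κ, ∀ x ∈ Q, ‖A κ x‖ ≤ C * ξ⁻¹)
    (hdA : ∀ μ ν, ∀ x ∈ Q, ‖((η : ℂ)⁻¹) • covD (shiftsV1 (PV d ℓ i.m i.K hd hL)) (fun _ _ => (1 : 𝔸ˣ)) μ (A ν) x‖ ≤ C * (ξ ^ 2)⁻¹)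
    (len : SiteY i → ℝ) (hlen : ∀ z, 0 < len z) (hlenΛ : ∀ z, len z ≤ Λ * ξ) :
    (∀ ν κ z, ‖((η : ℂ)⁻¹) • covDstar (shiftY i) (fun _ _ => (1 : 𝔸ˣ)) ν (chartA i (cutFldY i (chiTY i c) A) κ) z‖ ≤
        max C (C * (1 + D1 thetaProf)) * Λ ^ 2 * (len z ^ 2)⁻¹) ∧
    (∀ μ ν z, ‖((η : ℂ)⁻¹) • covD (shiftY i) (fun _ _ => (1 : 𝔸ˣ)) μ (chartA i (cutFldY i (chiTY i c) A) ν) z‖ ≤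
        max C (C * (1 + D1 thetaProf)) * Λ ^ 2 * (len z ^ 2)⁻¹) ∧
    (∀ μ z, ‖((η : ℂ)⁻¹) • covDstar (shiftY i) (fun _ _ => (1 : 𝔸ˣ)) μ
        (tauB (shiftY i) (fun _ _ => (1 : 𝔸ˣ)) μ (chartA i (cutFldY i (chiTY i c) A) μ)) z‖ ≤ max C (C * (1 + D1 thetaProf)) * Λ ^ 2 * (len z ^ 2)⁻¹) ∧
    (∀ κ z, ‖chartA i (cutFldY i (chiTY i c) A) κ z‖ ≤ max C (C * (1 + D1 thetaProf)) * Λ ^ 2 * (len z)⁻¹) ∧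
    (∀ ν κ z, ‖tauB (shiftY i) (fun _ _ => (1 : 𝔸ˣ)) ν (chartA i (cutFldY i (chiTY i c) A) κ) z‖ ≤ max C (C * (1 + D1 thetaProf)) * Λ ^ 2 * (len z)⁻¹) := by
  have hS1 := one_le_SC i c
  have hS : (1 : ℝ) ≤ (SC i c : ℝ) := by exact_mod_cast hS1
  have hD := D1_nonneg contDiff_thetaProf hasCompactSupport_thetaProf
  have hC' : 0 ≤ C * (1 + D1 thetaProf) := by positivity
  have hg : 0 ≤ D1 thetaProf / (5 * (SC i c : ℝ)) := by positivity
  refine B9Cor36CutoffField337.readings337_chartA_cutFldY i hC hC' hg hξ hΛ (fun z => (abs_chiY_le_one i c z).2)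
    (fun μ z => (abs_chi_shiftY_sub_le i c μ z).2.2.1) (fun z hz => hQ _ ?_) (fun μ z hz => hQ _ ?_) hA hdA ?_ len hlen hlenΛ
  · rw [Equiv.apply_symm_apply]
    exact (nearC_of_chiTY_ne_zero i c hz).mono i c (by linarith)
  · rw [Equiv.apply_symm_apply]
    have h := nearC_shiftY_symm i c (nearC_of_chiTY_ne_zero i c hz) μ
    rwa [Equiv.symm_apply_apply] at h
  · -- `|η|⁻¹·(D₁θ/(5S))·Cξ⁻¹ ≤ C·D₁θ·ξ⁻²` since `ξ ≤ 5Sη`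
    have hη' : |η| = η := abs_of_pos hη
    have hprod : 0 < |η| * (5 * (SC i c : ℝ)) := by rw [hη']; positivity
    have hinv : (|η| * (5 * (SC i c : ℝ)))⁻¹ ≤ ξ⁻¹ := inv_anti₀ hξ (by rw [hη']; linarith)
    have e1 : |η|⁻¹ * (D1 thetaProf / (5 * (SC i c : ℝ))) * (C * ξ⁻¹) = C * D1 thetaProf * ((|η| * (5 * (SC i c : ℝ)))⁻¹ * ξ⁻¹) := by
      rw [mul_inv, div_eq_mul_inv]; ring
    have e2 : (C * (1 + D1 thetaProf) - C) * (ξ ^ 2)⁻¹ = C * D1 thetaProf * (ξ⁻¹ * ξ⁻¹) := by rw [sq, mul_inv]; ring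
    rw [e1, e2]
    exact mul_le_mul_of_nonneg_left (mul_le_mul_of_nonneg_right hinv (inv_nonneg.2 hξ.le)) (by positivity)

/-- the cube sequence's lengths `L^{lev_□ z}η` are positive and at most `Λξ` once `L^{j+1}η ≤ Λξ` (`lev_□ ≤ j + 1`): the `len` of `thm34_Gp_uniform` at the
cube. [cite: Balaban1985BackgroundPropagators, p.408 («{Ω_n(□)}_{n=0,…,j+1}»), (3.41) p.397] -/
theorem scaleLen_levCubeY_bounds {L η ξ Λ : ℝ} (hL1 : 1 ≤ L) (hη : 0 < η)
    (hΛ : LatticeNorms.scaleLen L η (c.1.1 + 1) ≤ Λ * ξ) (z : SiteY i) :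
    0 < LatticeNorms.scaleLen L η (levCubeY i c z) ∧ LatticeNorms.scaleLen L η (levCubeY i c z) ≤ Λ * ξ := by
  refine ⟨B9Eq335RegularityClasses.scaleLen_pos hL1 hη _, le_trans ?_ hΛ⟩
  unfold LatticeNorms.scaleLen
  exact mul_le_mul_of_nonneg_right (pow_le_pow_right₀ hL1 (lev_cubeFam_le_succ z.1)) hη.le

/-- ★★ **FILE 2's TWO LOCAL-INVERSE LAWS FOR THE CUBE's LETTER `O_□ = χ_□ R(u)⁻¹ G′_□(Ṽ_□) R(u) χ_□` WITH `h := h_□`**, all geometric hypotheses discharged: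
for a transporter letter with the gauge law `hS` and locality `hpar` (e.g. `parSymY`), a gauge `u` and field `A` with `U^u = e^{iηA}` on the bonds
of a set `Q ⊇ {within 3S_j + 2 of the centre of β}` (the (3.35) datum, `exists_gauge_fld_of_reg335Cube`), and `Δ′_{a,□}(Ṽ_□)` invertible (Thm 3.4, FILE 5):
`h_□·Δ′_a(U)·O_□·h_□ = h_□²` and `h_□·O_□·Δ′_a(U)·h_□ = h_□²` — the consumer's `hloc`, `hlocT`.
[cite: Balaban1985BackgroundPropagators, Cor. 3.6 p.408, (3.88) p.409, (3.60) p.402, (3.31) p.395] -/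
theorem localInverse_laws_locLetterY {parS : Node00.SiteParY 𝔸 i} (hS : Node00.IsGaugeLawS i parS) (hpar : Node00.OpsYLocalInverseAgree.ParLocalY i parS)
    (g : GaugeY 𝔸 i) (U : CfgY 𝔸 i) {Q : Set (Site (PV d ℓ i.m i.K hd hL) 0)} (η : ℝ) (A : AfldY 𝔸 i)
    (hQ : ∀ x : Site (PV d ℓ i.m i.K hd hL) 0, NearC i c (3 * SC i c + 2) (boxEquiv i.hN x).1 → x ∈ Q)
    (hgA : ∀ (κ : Fin (d + 1)) (x : Site (PV d ℓ i.m i.K hd hL) 0), x ∈ Q → x.shift κ ∈ Q → gaugeY i g U κ x = fluct η A κ x)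
    (hunit : IsUnit (B9CubeLettersOpsL0.deltaPrimeACubeY i c parS (locCfgY i c η A))) :
    B9Thm37CubeCoverCommutators.cutMulY (fun z => hT (toKT i).D c z) * Node00.deltaPrimeAY i parS U *
        B9Cor36GpCubeLocLetter.locLetterY i c parS g (chiY i c) (locCfgY i c η A) * B9Thm37CubeCoverCommutators.cutMulY (fun z => hT (toKT i).D c z) =
      B9Thm37CubeCoverCommutators.cutMulY (fun z => hT (toKT i).D c z) * B9Thm37CubeCoverCommutators.cutMulY (fun z => hT (toKT i).D c z) ∧
    B9Thm37CubeCoverCommutators.cutMulY (fun z => hT (toKT i).D c z) * B9Cor36GpCubeLocLetter.locLetterY i c parS g (chiY i c) (locCfgY i c η A) *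
        Node00.deltaPrimeAY i parS U * B9Thm37CubeCoverCommutators.cutMulY (fun z => hT (toKT i).D c z) =
      B9Thm37CubeCoverCommutators.cutMulY (fun z => hT (toKT i).D c z) * B9Thm37CubeCoverCommutators.cutMulY (fun z => hT (toKT i).D c z) :=
  B9Cor36GpCubeLocLetter.localInverse_laws_of_agree i c hS hpar g U (locCfgY i c η A) (fun z => hT (toKT i).D c z) (chiY i c) (DthY i c)
    (fun _ _ hw h => mem_DthY i c hw h) (fun _ hz => nearH_of_mem_DthY i c hz) (fun _ hz _ hw => chiY_eq_one_of_mem_stencilY i c hz hw)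
    (agreeNearY_DthY_locCfgY i c η A hQ hgA) hunit

/-- ★★ the same at the record's transporter `parSymY` (gauge law and locality by NODE 00). [cite: Balaban1985BackgroundPropagators, Cor. 3.6 p.408, (3.88) p.409, (3.24) p.394] -/
theorem localInverse_laws_locLetterY_parSymY (g : GaugeY 𝔸 i) (U : CfgY 𝔸 i) {Q : Set (Site (PV d ℓ i.m i.K hd hL) 0)} (η : ℝ) (A : AfldY 𝔸 i)
    (hQ : ∀ x : Site (PV d ℓ i.m i.K hd hL) 0, NearC i c (3 * SC i c + 2) (boxEquiv i.hN x).1 → x ∈ Q)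
    (hgA : ∀ (κ : Fin (d + 1)) (x : Site (PV d ℓ i.m i.K hd hL) 0), x ∈ Q → x.shift κ ∈ Q → gaugeY i g U κ x = fluct η A κ x)
    (hunit : IsUnit (B9CubeLettersOpsL0.deltaPrimeACubeY i c (Node00.parSymY i) (locCfgY i c η A))) :
    B9Thm37CubeCoverCommutators.cutMulY (fun z => hT (toKT i).D c z) * Node00.deltaPrimeAY i (Node00.parSymY i) U *
        B9Cor36GpCubeLocLetter.locLetterY i c (Node00.parSymY i) g (chiY i c) (locCfgY i c η A) * B9Thm37CubeCoverCommutators.cutMulY (fun z => hT (toKT i).D c z) =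
      B9Thm37CubeCoverCommutators.cutMulY (fun z => hT (toKT i).D c z) * B9Thm37CubeCoverCommutators.cutMulY (fun z => hT (toKT i).D c z) ∧
    B9Thm37CubeCoverCommutators.cutMulY (fun z => hT (toKT i).D c z) * B9Cor36GpCubeLocLetter.locLetterY i c (Node00.parSymY i) g (chiY i c) (locCfgY i c η A) *
        Node00.deltaPrimeAY i (Node00.parSymY i) U * B9Thm37CubeCoverCommutators.cutMulY (fun z => hT (toKT i).D c z) =
      B9Thm37CubeCoverCommutators.cutMulY (fun z => hT (toKT i).D c z) * B9Thm37CubeCoverCommutators.cutMulY (fun z => hT (toKT i).D c z) :=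
  localInverse_laws_locLetterY i c (Node00.parSymY_isGaugeLawS i) (Node00.OpsYLocalInverseAgree.parLocalY_parSymY i) g U η A hQ hgA hunit

/-- ★★ the same, typed at the consumer's binders (p21's M5.5 FILE 6: `c : ↥(cubes i.D.toDomains)`, cut-off `hTY i c`).
[cite: Balaban1985BackgroundPropagators, Cor. 3.6 p.408, (3.87)–(3.88) p.409] -/
theorem localInverse_laws_hTY_parSymY (c : ↥(cubes i.D.toDomains)) (g : GaugeY 𝔸 i) (U : CfgY 𝔸 i) {Q : Set (Site (PV d ℓ i.m i.K hd hL) 0)}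
    (η : ℝ) (A : AfldY 𝔸 i)
    (hQ : ∀ x : Site (PV d ℓ i.m i.K hd hL) 0, NearC i c (3 * SC i c + 2) (boxEquiv i.hN x).1 → x ∈ Q)
    (hgA : ∀ (κ : Fin (d + 1)) (x : Site (PV d ℓ i.m i.K hd hL) 0), x ∈ Q → x.shift κ ∈ Q → gaugeY i g U κ x = fluct η A κ x)
    (hunit : IsUnit (B9CubeLettersOpsL0.deltaPrimeACubeY i c (Node00.parSymY i) (locCfgY i c η A))) :
    B9Thm37CubeCoverCommutators.cutMulY (B9Thm37CubeCoverCommutators.hTY i c) * Node00.deltaPrimeAY i (Node00.parSymY i) U *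
        B9Cor36GpCubeLocLetter.locLetterY i c (Node00.parSymY i) g (chiY i c) (locCfgY i c η A) *
        B9Thm37CubeCoverCommutators.cutMulY (B9Thm37CubeCoverCommutators.hTY i c) =
      B9Thm37CubeCoverCommutators.cutMulY (B9Thm37CubeCoverCommutators.hTY i c) * B9Thm37CubeCoverCommutators.cutMulY (B9Thm37CubeCoverCommutators.hTY i c) ∧
    B9Thm37CubeCoverCommutators.cutMulY (B9Thm37CubeCoverCommutators.hTY i c) *
        B9Cor36GpCubeLocLetter.locLetterY i c (Node00.parSymY i) g (chiY i c) (locCfgY i c η A) * Node00.deltaPrimeAY i (Node00.parSymY i) U *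
        B9Thm37CubeCoverCommutators.cutMulY (B9Thm37CubeCoverCommutators.hTY i c) =
      B9Thm37CubeCoverCommutators.cutMulY (B9Thm37CubeCoverCommutators.hTY i c) * B9Thm37CubeCoverCommutators.cutMulY (B9Thm37CubeCoverCommutators.hTY i c) :=
  localInverse_laws_locLetterY_parSymY i c g U η A hQ hgA hunit

end Datum

end Literature.MathematicalPhysics.QuantumFieldTheory.Balaban1983to89.B9Cor36CubeCutoffs

end
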